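import Literature.MathematicalPhysics.QuantumLattice.StructureFactorSumRuleFloor
import HarnessLib

/-!
# Per-mode ceiling on the pair structure factor from SECTOR data, for any eigenvector — the glue
# from `(K_m, ω_m, D_m)` to the ceilings `B_m` of `StructureFactorSumRuleFloor`

Follow-up to `GroundStateSectorGapModeBound.lean` (the spectral step `ω·S ≤ D` in a ground-SUPPORTED
state, reference energy `H.groundEnergy`) and to `StructureFactorSumRuleFloor.lean` (the `k = 0` assembly:
on-site floor + numeric ceilings `S_ψ(m) ≤ B_m`, `m ≠ 0` ⇒ floor on `S_ψ(0)` / on `L⁻⁴⟨Δ†Δ⟩`). The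
summit's states are SECTOR ground states `ψ_L` (fixed particle number and `S^z`): eigenvectors of `H`
whose eigenvalue `E` need not be the global ground energy of `H` on Fock space. This file supplies the
missing statement forms with a FREE eigenvalue `E` and the tree's sector energies `Matrix.minEnergyOn`:

* `gap_mul_normSq_le_moment_of_mem_sector` — `Aψ ∈ K`, `minEnergyOn H K ≥ E + ω` ⇒
  `ω‖Aψ‖² ≤ Re⟨Aψ,(H−E)Aψ⟩`; `moment_nonneg_of_mem_sector` (`ω = 0`).
* `dotProduct_doubleCommutator_eq_of_eigen` — `Hψ = Eψ` ⇒
  `⟨ψ,[A†,[H,A]]ψ⟩ = ⟨Aψ,(H−E)Aψ⟩ + ⟨A†ψ,(H−E)A†ψ⟩`; `moment_le_doubleCommutator_of_mem_sector` — if moreover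
  `A†ψ ∈ K'` with `minEnergyOn H K' ≥ E` (discrete convexity across charge sectors) then
  `Re⟨Aψ,(H−E)Aψ⟩ ≤ Re⟨ψ,[A†,[H,A]]ψ⟩`.
* `pairStructureFactor_le_div_of_sectorGap` — for the momentum-`q_m` pair mode `Δ_g(q_m) = pairFieldAt g L m`
  on the fermionic torus: `Δ_g(q_m)ψ ∈ K` (`minEnergyOn ≥ E + ω`, `ω > 0`), `Δ_g(q_m)†ψ ∈ K'`
  (`minEnergyOn ≥ E`), `Re⟨ψ,[Δ†,[H,Δ]]ψ⟩ ≤ D` ⇒ `S_ψ(m) ≤ D/(ω L²)` — Feynman–Bijl backwards, the `B_m`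
  of the assembly file.
* `pairFieldLRO_ge_of_onSite_floor_of_sectorGaps` — composition with
  `pairFieldLRO_ge_of_onSite_floor_of_ceilings` (p1's file): on-site floor `c L² ≤ Σ_x ‖P_xψ‖²` and sector data
  at every `m ≠ 0` ⇒ `c − L⁻² Σ_{m ≠ 0} D_m/(ω_m L²) ≤ L⁻⁴ Re⟨ψ, Δ_g†Δ_g ψ⟩`.

HONEST FRAMING: a TOOL, CONDITIONAL as an instrument — the yrast-type inputs `ω_m` (an `L`-uniform
`ω_m ≥ v|q_m|` for the charge-`∓2`, momentum-`±q_m` sectors) are asserted for no model and have no known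
certificate shape; «CONDITIONAL; at the CQ anchors the Cauchy–Schwarz/KLS closure needs condensate share
≳ 15 % of the d-wave pair sum rule, print-size order gives ≈ 1 % (cell hubbard-cq, Q-PCb-1 [float])».

## References
* R. P. Feynman, Phys. Rev. 94 (1954) 262 [Feynman1954], §III; L. Pitaevskii, S. Stringari,
  J. Low Temp. Phys. 85 (1991) 377 [PitaevskiiStringari1991], §2 (`ω_min · m₀ ≤ m₁`).
* T. Kennedy, E. H. Lieb, B. S. Shastry, PRL 61 (1988) 2582 [KLS1988PRL], p. 2583.
* H. Tasaki, *Physics and Mathematics of Quantum Many-Body Systems* (2020), §2.2 [Tasaki2020]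
  (sector energies).
-/

noncomputable section

namespace Literature.MathematicalPhysics.QuantumLattice

open Matrix Finset
open scoped ComplexOrder BigOperators

/-! ### Eigenvector forms of the spectral step -/

section Eigen

variable {n : Type*} [Fintype n] [DecidableEq n] {H A : Matrix n n ℂ} {ψ : n → ℂ} {E ω : ℝ}

/-- **Sector-gap step for an eigenvalue `E`**: if `Aψ ∈ K` and `minEnergyOn H K ≥ E + ω` then
`ω · ‖Aψ‖² ≤ Re⟨Aψ, (H − E)Aψ⟩` (the variational principle in the sector `K`).
[cite: PitaevskiiStringari1991, §2] [cite: Tasaki2020, §2.2] -/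
theorem gap_mul_normSq_le_moment_of_mem_sector (hH : H.IsHermitian) (K : Submodule ℂ (n → ℂ))
    (hAψ : A *ᵥ ψ ∈ K) (hK : E + ω ≤ H.minEnergyOn K) :
    ω * (star (A *ᵥ ψ) ⬝ᵥ (A *ᵥ ψ)).re ≤
      (star (A *ᵥ ψ) ⬝ᵥ (H - (E : ℂ) • 1) *ᵥ (A *ᵥ ψ)).re := by
  have h := minEnergyOn_mul_le_rayleigh_of_mem hH K hAψ
  have hnn : 0 ≤ (star (A *ᵥ ψ) ⬝ᵥ (A *ᵥ ψ)).re :=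
    (Complex.nonneg_iff.1 (dotProduct_star_self_nonneg _)).1
  rw [sub_mulVec, dotProduct_sub, smul_mulVec, one_mulVec, dotProduct_smul, Complex.sub_re,
    smul_eq_mul, Complex.re_ofReal_mul]
  nlinarith

/-- The `ω = 0` case: `Aψ ∈ K` and `minEnergyOn H K ≥ E` give `0 ≤ Re⟨Aψ, (H − E)Aψ⟩`.
[cite: Tasaki2020, §2.2] -/
theorem moment_nonneg_of_mem_sector (hH : H.IsHermitian) (K : Submodule ℂ (n → ℂ))
    (hAψ : A *ᵥ ψ ∈ K) (hK : E ≤ H.minEnergyOn K) :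
    0 ≤ (star (A *ᵥ ψ) ⬝ᵥ (H - (E : ℂ) • 1) *ᵥ (A *ᵥ ψ)).re := by
  have h := gap_mul_normSq_le_moment_of_mem_sector (ω := 0) hH K hAψ (by simpa using hK)
  simpa using h

omit [DecidableEq n] in
/-- `H (ψ ψ†) = E (ψ ψ†)` from `Hψ = Eψ`. [folklore] -/
private theorem mul_vecMulVec_star_of_eigen (hψ : H *ᵥ ψ = (E : ℂ) • ψ) :
    H * vecMulVec ψ (star ψ) = (E : ℂ) • vecMulVec ψ (star ψ) := by
  ext i j
  have h := congrFun hψ i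
  simp only [mulVec, dotProduct, Pi.smul_apply, smul_eq_mul] at h
  simp only [Matrix.mul_apply, vecMulVec_apply, Matrix.smul_apply, smul_eq_mul, ← mul_assoc,
    ← Finset.sum_mul, h]

omit [DecidableEq n] in
/-- `(ψ ψ†) H = E (ψ ψ†)` from `Hψ = Eψ`, `H` Hermitian, `E` real. [folklore] -/
private theorem vecMulVec_star_mul_of_eigen (hH : H.IsHermitian) (hψ : H *ᵥ ψ = (E : ℂ) • ψ) :
    vecMulVec ψ (star ψ) * H = (E : ℂ) • vecMulVec ψ (star ψ) := by
  have h := congrArg conjTranspose (mul_vecMulVec_star_of_eigen hψ)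
  rwa [conjTranspose_mul, conjTranspose_smul, hH.eq, conjTranspose_vecMulVec, star_star,
    Complex.star_def, Complex.conj_ofReal] at h

/-- **The double commutator splits into the two one-sided moments** for an eigenvector `ψ`
(`Hψ = Eψ`, `E` real): `⟨ψ,[A†,[H,A]]ψ⟩ = ⟨Aψ,(H−E)Aψ⟩ + ⟨A†ψ,(H−E)A†ψ⟩`,
`[A†,[H,A]] = A†(HA − AH) − (HA − AH)A†`. [cite: PitaevskiiStringari1991, §2] -/
theorem dotProduct_doubleCommutator_eq_of_eigen (hH : H.IsHermitian)
    (hψ : H *ᵥ ψ = (E : ℂ) • ψ) :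
    star ψ ⬝ᵥ (Aᴴ * (H * A - A * H) - (H * A - A * H) * Aᴴ) *ᵥ ψ =
      star (A *ᵥ ψ) ⬝ᵥ (H - (E : ℂ) • 1) *ᵥ (A *ᵥ ψ) +
        star (Aᴴ *ᵥ ψ) ⬝ᵥ (H - (E : ℂ) • 1) *ᵥ (Aᴴ *ᵥ ψ) := by
  have hρ := trace_doubleCommutator_eq_of_groundSupported (A := A)
    (mul_vecMulVec_star_of_eigen hψ) (vecMulVec_star_mul_of_eigen hH hψ)
  rw [dotProduct_doubleCommutator_eq.trace_vecMulVec_mul',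
    dotProduct_doubleCommutator_eq.trace_vecMulVec_mul',
    dotProduct_doubleCommutator_eq.trace_vecMulVec_mul'] at hρ
  rw [hρ, ← mulVec_mulVec, ← mulVec_mulVec, ← mulVec_mulVec, ← mulVec_mulVec,
    dotProduct_mulVec (star ψ) Aᴴ, dotProduct_mulVec (star ψ) A, vecMul_conjTranspose, star_star,
    ← conjTranspose_conjTranspose A, vecMul_conjTranspose, conjTranspose_conjTranspose, star_star]

/-- **One-sided moment ≤ double commutator.** For an eigenvector `ψ` (`Hψ = Eψ`), if `A†ψ` lies in a
subspace `K'` whose sector energy is `≥ E` (so its moment is nonnegative), then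
`Re⟨Aψ,(H−E)Aψ⟩ ≤ Re⟨ψ,[A†,[H,A]]ψ⟩`. [cite: PitaevskiiStringari1991, §2] -/
theorem moment_le_doubleCommutator_of_mem_sector (hH : H.IsHermitian) (hψ : H *ᵥ ψ = (E : ℂ) • ψ)
    (K' : Submodule ℂ (n → ℂ)) (hA' : Aᴴ *ᵥ ψ ∈ K') (hK' : E ≤ H.minEnergyOn K') :
    (star (A *ᵥ ψ) ⬝ᵥ (H - (E : ℂ) • 1) *ᵥ (A *ᵥ ψ)).re ≤
      (star ψ ⬝ᵥ (Aᴴ * (H * A - A * H) - (H * A - A * H) * Aᴴ) *ᵥ ψ).re := by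
  rw [dotProduct_doubleCommutator_eq_of_eigen hH hψ, Complex.add_re]
  linarith [moment_nonneg_of_mem_sector (A := Aᴴ) hH K' hA' hK']

end Eigen

/-! ### The pair structure factor on the fermionic torus -/

section Torus

open HubbardWave0 Literature.Probability.LatticeModels

variable (g : Site 2 → ℝ) (L : ℕ) [NeZero L]

/-- **Per-mode ceiling on the pair structure factor from a sector gap** (Feynman–Bijl backwards). For
an eigenvector `ψ` of a Hermitian `H` on the torus Fock space (`Hψ = Eψ`) and a momentum label `m`: if
`Δ_g(q_m)ψ ∈ K` with `minEnergyOn H K ≥ E + ω`, `ω > 0`, `Δ_g(q_m)†ψ ∈ K'` with `minEnergyOn H K' ≥ E`,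
and `Re⟨ψ,[Δ_g(q_m)†,[H,Δ_g(q_m)]]ψ⟩ ≤ D`, then `S_ψ(m) ≤ D/(ω L²)` — the input `B_m` of
`pairStructureFactor_zero_ge_of_onSite_floor_of_ceilings`. [cite: Feynman1954, §III] [cite: KLS1988PRL, p. 2583] -/
theorem pairStructureFactor_le_div_of_sectorGap
    {H : Matrix (Finset (Orb (FermionTorus 2 L))) (Finset (Orb (FermionTorus 2 L))) ℂ}
    (hH : H.IsHermitian) {ψ : Fock (Orb (FermionTorus 2 L))} {E : ℝ}
    (hψ : H *ᵥ ψ = (E : ℂ) • ψ) (m : TorusSite 2 L)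
    (K K' : Submodule ℂ (Fock (Orb (FermionTorus 2 L)))) {ω D : ℝ}
    (hmem : pairFieldAt g L m *ᵥ ψ ∈ K) (hmem' : (pairFieldAt g L m)ᴴ *ᵥ ψ ∈ K')
    (hω : 0 < ω) (hK : E + ω ≤ H.minEnergyOn K) (hK' : E ≤ H.minEnergyOn K')
    (hD : (star ψ ⬝ᵥ ((pairFieldAt g L m)ᴴ * (H * pairFieldAt g L m - pairFieldAt g L m * H) -
        (H * pairFieldAt g L m - pairFieldAt g L m * H) * (pairFieldAt g L m)ᴴ) *ᵥ ψ).re ≤ D) :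
    pairStructureFactor g L ψ m ≤ D / (ω * (L : ℝ) ^ 2) := by
  have hL : 0 < (L : ℝ) ^ 2 := by
    have : (0 : ℝ) < L := Nat.cast_pos.2 (Nat.pos_of_ne_zero (NeZero.ne L))
    positivity
  have h1 := gap_mul_normSq_le_moment_of_mem_sector hH K hmem hK
  have h2 := moment_le_doubleCommutator_of_mem_sector hH hψ K' hmem' hK'
  have h3 : ω * (star (pairFieldAt g L m *ᵥ ψ) ⬝ᵥ (pairFieldAt g L m *ᵥ ψ)).re ≤ D :=
    h1.trans (h2.trans hD)
  rw [pairStructureFactor_apply, div_le_div_iff₀ hL (mul_pos hω hL)]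
  nlinarith [h3, hL]

/-- **Composition with the assembly file**: for an eigenvector `ψ` (`Hψ = Eψ`), an on-site floor
`c L² ≤ Σ_x ‖P_xψ‖²` and, at every `m ≠ 0`, sector data `K m, K' m, ω m > 0, D m` as in
`pairStructureFactor_le_div_of_sectorGap`, the long-range-order density obeys
`c − L⁻² Σ_{m ≠ 0} D_m/(ω_m L²) ≤ L⁻⁴ Re⟨ψ, Δ_g†Δ_g ψ⟩` (via `pairFieldLRO_ge_of_onSite_floor_of_ceilings`).
CONDITIONAL as an instrument: the `ω m` are inputs asserted for no model. [cite: KLS1988PRL, p. 2583] -/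
theorem pairFieldLRO_ge_of_onSite_floor_of_sectorGaps
    {H : Matrix (Finset (Orb (FermionTorus 2 L))) (Finset (Orb (FermionTorus 2 L))) ℂ}
    (hH : H.IsHermitian) {ψ : Fock (Orb (FermionTorus 2 L))} {E : ℝ}
    (hψ : H *ᵥ ψ = (E : ℂ) • ψ)
    (K K' : TorusSite 2 L → Submodule ℂ (Fock (Orb (FermionTorus 2 L)))) (ω D : TorusSite 2 L → ℝ)
    {c : ℝ} (hfloor : c * (L : ℝ) ^ 2 ≤ ∑ x, (star (localPair g L x *ᵥ ψ) ⬝ᵥ (localPair g L x *ᵥ ψ)).re)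
    (hmem : ∀ m, m ≠ 0 → pairFieldAt g L m *ᵥ ψ ∈ K m)
    (hmem' : ∀ m, m ≠ 0 → (pairFieldAt g L m)ᴴ *ᵥ ψ ∈ K' m)
    (hω : ∀ m, m ≠ 0 → 0 < ω m) (hK : ∀ m, m ≠ 0 → E + ω m ≤ H.minEnergyOn (K m))
    (hK' : ∀ m, m ≠ 0 → E ≤ H.minEnergyOn (K' m))
    (hD : ∀ m, m ≠ 0 →
      (star ψ ⬝ᵥ ((pairFieldAt g L m)ᴴ * (H * pairFieldAt g L m - pairFieldAt g L m * H) -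
        (H * pairFieldAt g L m - pairFieldAt g L m * H) * (pairFieldAt g L m)ᴴ) *ᵥ ψ).re ≤ D m) :
    c - (∑ m ∈ (univ : Finset (TorusSite 2 L)).erase 0, D m / (ω m * (L : ℝ) ^ 2)) / (L : ℝ) ^ 2 ≤
      (expect ((pairField g L)ᴴ * pairField g L) ψ).re / (L : ℝ) ^ 4 :=
  pairFieldLRO_ge_of_onSite_floor_of_ceilings g L ψ (fun m => D m / (ω m * (L : ℝ) ^ 2)) hfloor
    fun m hm => pairStructureFactor_le_div_of_sectorGap g L hH hψ m (K m) (K' m) (hmem m hm) (hmem' m hm)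
      (hω m hm) (hK m hm) (hK' m hm) (hD m hm)

end Torus

end Literature.MathematicalPhysics.QuantumLattice
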